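import Literature.Analysis.FluidPDE.PassiveScalarSpectralBounds
import Literature.Analysis.FunctionSpaces.TorusMollifiedGradNorm
import HarnessLib

/-!
# Tools for pairing identities of weak passive scalars: adjoint of the mollified flux,
# spectral contraction of mollification

Analysis/FluidPDE proof-support file (everything proved). Three slice facts on the flat torus
used by the pairing identities between two weak passive scalars driven by the same drift
(age-decoupling argument, `FluidPDE/AgeDecouplingInequality`):

* `eScalarGradNormSq_convolution_le` — mollification by a nonnegative unit-mass kernel does not
  increase the spectral gradient norm, `eScalarGradNormSq (θ ⋆ ρ) ≤ eScalarGradNormSq θ`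
  (`|ρ̂(k)| ≤ 1` termwise);
* `integral_mul_molInt_eq` — the adjoint of mollification by an EVEN kernel,
  `∫ A(x) (∫ B(y) k(x-y) dy) dx = ∫ B(y) (A ⋆ k)(y) dy`;
* `integral_mul_fluxIntegral_eq` — the adjoint of the mollified flux of the tree's mollified
  equation (`PassiveScalarEnergyMollified`): for an even smooth kernel `k`,
  `∫ A(x) (∫ B(y) (-⟪V(y), ∇k(x-y)⟫ + κ Δk(x-y)) dy) dx = ∫ B(y) (⟪V(y), ∇(A ⋆ k)(y)⟫ + κ Δ(A ⋆ k)(y)) dy`,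
  i.e. testing the mollified equation of `B` against a smooth `A` is testing the weak formulation
  of `B` against the steady smooth field `A ⋆ k` (DiPerna–Lions 1989, §II.1, (13)–(14)).

## References

* R. J. DiPerna, P.-L. Lions, Invent. Math. 98 (1989), 511–547, §II.1. [`DiPernaLions1989`]
* L. C. Evans, *Partial Differential Equations*, 2nd ed. (2010), App. C.4 Thm. 7. [`Evans2010`]
-/

noncomputable section

open MeasureTheory TopologicalSpace Set Function Filter Topology Metric ContinuousLinearMap
  UnitAddTorus
open scoped ENNReal NNReal Convolution ContDiff InnerProductSpace

namespace Literature.Analysis.FluidPDE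

namespace Torus

variable {d : Type*} [Fintype d]

/-! ## Mollification contracts the spectral gradient norm -/

/-- **Mollification does not increase the spectral gradient norm of a scalar**:
`eScalarGradNormSq (θ ⋆ ρ) ≤ eScalarGradNormSq θ` for integrable `θ` and a continuous kernel
`ρ ≥ 0` of unit mass (`𝓕(θ ⋆ ρ) = θ̂ ρ̂`, `|ρ̂| ≤ 1`). [folklore] -/
theorem eScalarGradNormSq_convolution_le {θ ρ : UnitAddTorus d → ℝ} (hθ : Integrable θ volume)
    (hρc : Continuous ρ) (hρ0 : ∀ y, 0 ≤ ρ y) (hρ1 : ∫ y, ρ y = 1) :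
    eScalarGradNormSq (θ ⋆ ρ) ≤ eScalarGradNormSq θ := by
  rw [eScalarGradNormSq_eq_tsum', eScalarGradNormSq_eq_tsum']
  refine ENNReal.tsum_le_tsum fun k => ?_
  have h1 : ‖mFourierCoeff (fun x => ((θ ⋆ ρ) x : ℂ)) k‖ₑ ≤ ‖mFourierCoeff (fun x => (θ x : ℂ)) k‖ₑ := by
    rw [FunctionSpaces.Torus.mFourierCoeff_ofReal_convolution_kernel hθ hρc k, enorm_mul]
    have h2 : ‖mFourierCoeff (fun x => (ρ x : ℂ)) k‖ₑ ≤ 1 := by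
      rw [← ofReal_norm, ← ENNReal.ofReal_one]
      exact ENNReal.ofReal_le_ofReal (FunctionSpaces.Torus.norm_mFourierCoeff_ofReal_le_one hρc hρ0 hρ1 k)
    calc ‖mFourierCoeff (fun x => (θ x : ℂ)) k‖ₑ * ‖mFourierCoeff (fun x => (ρ x : ℂ)) k‖ₑ
        ≤ ‖mFourierCoeff (fun x => (θ x : ℂ)) k‖ₑ * 1 := by gcongr
      _ = _ := mul_one _
  gcongr

/-! ## Parity of an even kernel's derivatives -/

/-- The gradient of an even function is odd. [folklore] -/
private theorem gradient_neg_of_even_kernel {k : UnitAddTorus d → ℝ} (hke : ∀ z, k (-z) = k z) (z : UnitAddTorus d) :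
    FunctionSpaces.Torus.gradient k (-z) = -FunctionSpaces.Torus.gradient k z := by
  have h := FunctionSpaces.Torus.gradient_comp_sub_left k 0 (-z)
  have e : (fun y => k (0 - y)) = k := by
    funext y; rw [zero_sub, hke]
  rw [e, zero_sub, neg_neg] at h
  exact h

/-- The Laplacian of an even smooth function is even. [folklore] -/
private theorem laplacian_neg_of_even_kernel {k : UnitAddTorus d → ℝ} (hk : FunctionSpaces.Torus.IsSmooth k)
    (hke : ∀ z, k (-z) = k z) (z : UnitAddTorus d) :
    FunctionSpaces.Torus.laplacian k (-z) = FunctionSpaces.Torus.laplacian k z := by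
  have h := FunctionSpaces.Torus.laplacian_comp_sub_left hk 0 (-z)
  have e : (fun y => k (0 - y)) = k := by
    funext y; rw [zero_sub, hke]
  rw [e, zero_sub, neg_neg] at h
  exact h

/-! ## Adjoint of mollification and of the mollified flux -/

section Adjoint

variable {A B k : UnitAddTorus d → ℝ} {V : UnitAddTorus d → EuclideanSpace ℝ d}

/-- **Adjoint of mollification by an even kernel**:
`∫ A(x) (∫ B(y) k(x-y) dy) dx = ∫ B(y) (A ⋆ k)(y) dy` for continuous `A`, `k` and integrable `B`
(Fubini). [folklore] -/
theorem integral_mul_molInt_eq (hA : Continuous A) (hB : Integrable B volume) (hk : Continuous k)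
    (hke : ∀ z, k (-z) = k z) :
    ∫ x, A x * (∫ y, B y * k (x - y)) = ∫ y, B y * (A ⋆ k) y := by
  obtain ⟨CA, hCA⟩ := FunctionSpaces.Torus.exists_forall_norm_le_of_continuous hA
  obtain ⟨Ck, hCk⟩ := FunctionSpaces.Torus.exists_forall_norm_le_of_continuous hk
  have hCA0 : 0 ≤ CA := (norm_nonneg _).trans (hCA 0)
  have hCk0 : 0 ≤ Ck := (norm_nonneg _).trans (hCk 0)
  set F : UnitAddTorus d × UnitAddTorus d → ℝ := fun p => A p.1 * (B p.2 * k (p.1 - p.2)) with hF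
  have hFm : AEStronglyMeasurable F ((volume : Measure (UnitAddTorus d)).prod volume) :=
    ((hA.comp continuous_fst).aestronglyMeasurable).mul
      ((hB.aestronglyMeasurable.comp_snd).mul (hk.comp (continuous_fst.sub continuous_snd)).aestronglyMeasurable)
  have hFi : Integrable F ((volume : Measure (UnitAddTorus d)).prod volume) := by
    refine Integrable.mono' ((integrable_const (CA * Ck)).mul_prod hB.abs) hFm (Eventually.of_forall fun p => ?_)
    simp only [hF, norm_mul, Real.norm_eq_abs]
    calc |A p.1| * (|B p.2| * |k (p.1 - p.2)|) ≤ CA * (|B p.2| * Ck) := by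
          refine mul_le_mul (by simpa [Real.norm_eq_abs] using hCA p.1)
            (mul_le_mul_of_nonneg_left (by simpa [Real.norm_eq_abs] using hCk (p.1 - p.2)) (abs_nonneg _))
            (by positivity) hCA0
      _ = CA * Ck * |B p.2| := by ring
  have hswap := integral_integral_swap (f := fun x y => A x * (B y * k (x - y))) hFi
  have eL : ∫ x, A x * (∫ y, B y * k (x - y)) = ∫ x, ∫ y, A x * (B y * k (x - y)) := by
    refine integral_congr_ae (Eventually.of_forall fun x => ?_)
    exact (MeasureTheory.integral_const_mul _ _).symm
  rw [eL, hswap]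
  refine integral_congr_ae (Eventually.of_forall fun y => ?_)
  dsimp only
  have e1 : (fun x => A x * (B y * k (x - y))) = fun x => B y * (A x * k (y - x)) := by
    funext x
    rw [← hke (y - x), neg_sub]
    ring
  rw [e1, MeasureTheory.integral_const_mul, convolution_lsmul]
  simp only [smul_eq_mul]

/-- **Adjoint of the mollified flux** (testing the mollified equation of `B` against a smooth
`A` is testing the weak formulation of `B` against `A ⋆ k`; DiPerna–Lions 1989, §II.1): for
continuous `A`, integrable `B` with `‖V‖ B ∈ L¹`, a.e.-measurable `V` and an even smooth kernel
`k`, `∫ A(x) (∫ B(y) (-⟪V(y), ∇k(x-y)⟫ + κ Δk(x-y)) dy) dx =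
∫ B(y) (⟪V(y), ∇(A ⋆ k)(y)⟫ + κ Δ(A ⋆ k)(y)) dy`. [cite: DiPernaLions1989, §II.1 (13)–(14)] -/
theorem integral_mul_fluxIntegral_eq (hA : Continuous A) (hB : Integrable B volume)
    (hV : AEStronglyMeasurable V volume) (hVB : Integrable (fun y => ‖V y‖ * B y) volume)
    (hk : FunctionSpaces.Torus.IsSmooth k) (hke : ∀ z, k (-z) = k z) (κ : ℝ) :
    ∫ x, A x * (∫ y, B y * (-⟪V y, FunctionSpaces.Torus.gradient k (x - y)⟫_ℝ +
        κ * FunctionSpaces.Torus.laplacian k (x - y))) =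
      ∫ y, B y * (⟪V y, FunctionSpaces.Torus.gradient (A ⋆ k) y⟫_ℝ +
        κ * FunctionSpaces.Torus.laplacian (A ⋆ k) y) := by
  have hAi : Integrable A volume := hA.integrable_unitAddTorus
  obtain ⟨CA, hCA⟩ := FunctionSpaces.Torus.exists_forall_norm_le_of_continuous hA
  obtain ⟨C₂, hC₂⟩ := FunctionSpaces.Torus.exists_forall_norm_le_of_continuous hk.gradient.continuous
  obtain ⟨C₃, hC₃⟩ := FunctionSpaces.Torus.exists_forall_norm_le_of_continuous hk.laplacian.continuous
  have hCA0 : 0 ≤ CA := (norm_nonneg _).trans (hCA 0)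
  have hko : ∀ z, FunctionSpaces.Torus.gradient k (-z) = -FunctionSpaces.Torus.gradient k z :=
    gradient_neg_of_even_kernel hke
  have hkl : ∀ z, FunctionSpaces.Torus.laplacian k (-z) = FunctionSpaces.Torus.laplacian k z :=
    laplacian_neg_of_even_kernel hk hke
  -- the space–space integrand and its integrability
  set w : UnitAddTorus d → UnitAddTorus d → ℝ := fun y z =>
    -⟪V y, FunctionSpaces.Torus.gradient k z⟫_ℝ + κ * FunctionSpaces.Torus.laplacian k z with hw
  set F : UnitAddTorus d × UnitAddTorus d → ℝ := fun p => A p.1 * (B p.2 * w p.2 (p.1 - p.2)) with hF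
  have hgc : Continuous fun p : UnitAddTorus d × UnitAddTorus d => FunctionSpaces.Torus.gradient k (p.1 - p.2) :=
    hk.gradient.continuous.comp (continuous_fst.sub continuous_snd)
  have hlc : Continuous fun p : UnitAddTorus d × UnitAddTorus d => FunctionSpaces.Torus.laplacian k (p.1 - p.2) :=
    hk.laplacian.continuous.comp (continuous_fst.sub continuous_snd)
  have hFm : AEStronglyMeasurable F ((volume : Measure (UnitAddTorus d)).prod volume) := by
    refine ((hA.comp continuous_fst).aestronglyMeasurable).mul ((hB.aestronglyMeasurable.comp_snd).mul ?_)
    exact ((hV.comp_snd.inner hgc.aestronglyMeasurable).neg).add (aestronglyMeasurable_const.mul hlc.aestronglyMeasurable)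
  have hbound : ∀ p : UnitAddTorus d × UnitAddTorus d, ‖F p‖ ≤ CA * (C₂ * (‖V p.2‖ * |B p.2|) + |κ| * C₃ * |B p.2|) := by
    intro p
    simp only [hF, hw, norm_mul, Real.norm_eq_abs]
    have h2 : |⟪V p.2, FunctionSpaces.Torus.gradient k (p.1 - p.2)⟫_ℝ| ≤ ‖V p.2‖ * C₂ :=
      (abs_real_inner_le_norm _ _).trans (mul_le_mul_of_nonneg_left (hC₂ _) (norm_nonneg _))
    have h3 : |κ * FunctionSpaces.Torus.laplacian k (p.1 - p.2)| ≤ |κ| * C₃ := by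
      rw [abs_mul]
      exact mul_le_mul_of_nonneg_left (by simpa [Real.norm_eq_abs] using hC₃ (p.1 - p.2)) (abs_nonneg _)
    have h4 : |-⟪V p.2, FunctionSpaces.Torus.gradient k (p.1 - p.2)⟫_ℝ + κ * FunctionSpaces.Torus.laplacian k (p.1 - p.2)| ≤
        ‖V p.2‖ * C₂ + |κ| * C₃ := (abs_add_le _ _).trans (add_le_add (by rwa [abs_neg]) h3)
    calc |A p.1| * (|B p.2| * |-⟪V p.2, FunctionSpaces.Torus.gradient k (p.1 - p.2)⟫_ℝ +
          κ * FunctionSpaces.Torus.laplacian k (p.1 - p.2)|)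
        ≤ CA * (|B p.2| * (‖V p.2‖ * C₂ + |κ| * C₃)) :=
          mul_le_mul (by simpa [Real.norm_eq_abs] using hCA p.1) (mul_le_mul_of_nonneg_left h4 (abs_nonneg _))
            (by positivity) hCA0
      _ = CA * (C₂ * (‖V p.2‖ * |B p.2|) + |κ| * C₃ * |B p.2|) := by ring
  have hmi : Integrable (fun y => C₂ * (‖V y‖ * |B y|) + |κ| * C₃ * |B y|) volume := by
    have h1 : Integrable (fun y => ‖V y‖ * |B y|) volume := by
      refine hVB.norm.congr (Eventually.of_forall fun y => ?_)
      simp [Real.norm_eq_abs]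
    exact (h1.const_mul C₂).add (hB.abs.const_mul (|κ| * C₃))
  have hFi : Integrable F ((volume : Measure (UnitAddTorus d)).prod volume) :=
    Integrable.mono' ((integrable_const CA).mul_prod hmi) hFm (Eventually.of_forall hbound)
  have hswap := integral_integral_swap (f := fun x y => A x * (B y * w y (x - y))) hFi
  have eL : ∫ x, A x * (∫ y, B y * w y (x - y)) = ∫ x, ∫ y, A x * (B y * w y (x - y)) := by
    refine integral_congr_ae (Eventually.of_forall fun x => ?_)
    exact (MeasureTheory.integral_const_mul _ _).symm
  have eL' : (∫ x, A x * (∫ y, B y * (-⟪V y, FunctionSpaces.Torus.gradient k (x - y)⟫_ℝ +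
      κ * FunctionSpaces.Torus.laplacian k (x - y)))) = ∫ x, A x * (∫ y, B y * w y (x - y)) := rfl
  rw [eL', eL, hswap]
  refine integral_congr_ae (Eventually.of_forall fun y => ?_)
  dsimp only
  -- the inner integral at fixed `y`
  have hsc : Continuous fun x => A x • FunctionSpaces.Torus.gradient k (y - x) :=
    hA.smul (hk.gradient.continuous.comp (continuous_const.sub continuous_id))
  have i1 : Integrable (fun x => A x * ⟪V y, FunctionSpaces.Torus.gradient k (x - y)⟫_ℝ) volume :=
    (hA.mul (continuous_const.inner (hk.gradient.continuous.comp (continuous_id.sub continuous_const)))).integrable_unitAddTorus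
  have i2 : Integrable (fun x => A x * (κ * FunctionSpaces.Torus.laplacian k (x - y))) volume :=
    (hA.mul (continuous_const.mul (hk.laplacian.continuous.comp (continuous_id.sub continuous_const)))).integrable_unitAddTorus
  have e1 : (fun x => A x * (B y * w y (x - y))) =
      fun x => B y * (-(A x * ⟪V y, FunctionSpaces.Torus.gradient k (x - y)⟫_ℝ) +
        A x * (κ * FunctionSpaces.Torus.laplacian k (x - y))) := by
    funext x; simp only [hw]; ring
  have i1' : Integrable (fun x => -(A x * ⟪V y, FunctionSpaces.Torus.gradient k (x - y)⟫_ℝ)) volume := i1.neg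
  rw [e1, MeasureTheory.integral_const_mul, integral_add i1' i2, integral_neg]
  congr 1
  -- gradient part
  have eg : ∫ x, A x * ⟪V y, FunctionSpaces.Torus.gradient k (x - y)⟫_ℝ =
      -⟪V y, FunctionSpaces.Torus.gradient (A ⋆ k) y⟫_ℝ := by
    have e2 : (fun x => A x * ⟪V y, FunctionSpaces.Torus.gradient k (x - y)⟫_ℝ) =
        fun x => -⟪V y, A x • FunctionSpaces.Torus.gradient k (y - x)⟫_ℝ := by
      funext x
      rw [← neg_sub y x, hko, real_inner_smul_right, inner_neg_right]
      ring
    rw [e2, integral_neg, integral_inner hsc.integrable_unitAddTorus, FunctionSpaces.Torus.gradient_convolution hAi hk y,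
      convolution_lsmul]
  -- Laplacian part
  have el : ∫ x, A x * (κ * FunctionSpaces.Torus.laplacian k (x - y)) =
      κ * FunctionSpaces.Torus.laplacian (A ⋆ k) y := by
    have e3 : (fun x => A x * (κ * FunctionSpaces.Torus.laplacian k (x - y))) =
        fun x => κ * (A x * FunctionSpaces.Torus.laplacian k (y - x)) := by
      funext x
      rw [← neg_sub y x, hkl]
      ring
    rw [e3, MeasureTheory.integral_const_mul, FunctionSpaces.Torus.laplacian_convolution hAi hk y, convolution_lsmul]
    simp only [smul_eq_mul]
  rw [eg, el]
  ring

end Adjoint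

/-! ## Sup bounds and uniform convergence of mollifications -/

section Sup

variable {F' : Type*} [NormedAddCommGroup F'] [NormedSpace ℝ F'] [CompleteSpace F']

/-- **Mollification by a probability kernel does not increase the sup norm**:
`‖(k ⋆ F)(y)‖ ≤ C` if `‖F‖ ≤ C`, `k ≥ 0`, `∫ k = 1`. [folklore] -/
theorem norm_convolution_le_of_forall_norm_le {F : UnitAddTorus d → F'} (hFm : AEStronglyMeasurable F volume)
    {C : ℝ} (hC : ∀ x, ‖F x‖ ≤ C) {k : UnitAddTorus d → ℝ} (hk0 : ∀ x, 0 ≤ k x) (hk1 : ∫ x, k x = 1)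
    (y : UnitAddTorus d) : ‖(k ⋆[lsmul ℝ ℝ] F) y‖ ≤ C := by
  have hC0 : 0 ≤ C := (norm_nonneg _).trans (hC 0)
  have hsupp : support k ⊆ ball (0 : UnitAddTorus d) 1 := fun z _ =>
    mem_ball_zero_iff.2 ((FunctionSpaces.Torus.norm_le_half z).trans_lt (by norm_num))
  have h := dist_convolution_le (x₀ := y) (z₀ := (0 : F')) hC0 hsupp hk0 hk1 hFm
    (fun x _ => by rw [dist_zero_right]; exact hC x)
  rwa [dist_zero_right] at h

/-- Scalar form with the kernel on the right: `|(F ⋆ k)(y)| ≤ C` if `|F| ≤ C`, `k ≥ 0`,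
`∫ k = 1`. [folklore] -/
theorem abs_convolution_le_of_forall_abs_le {F : UnitAddTorus d → ℝ} (hFm : AEStronglyMeasurable F volume)
    {C : ℝ} (hC : ∀ x, |F x| ≤ C) {k : UnitAddTorus d → ℝ} (hk0 : ∀ x, 0 ≤ k x) (hk1 : ∫ x, k x = 1)
    (y : UnitAddTorus d) : |(F ⋆ k) y| ≤ C := by
  rw [FunctionSpaces.Torus.convolution_comm_real, ← Real.norm_eq_abs]
  exact norm_convolution_le_of_forall_norm_le hFm (fun x => by rw [Real.norm_eq_abs]; exact hC x) hk0 hk1 y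

/-- **Uniform convergence of mollifications of a continuous function** along kernels
`kₙ ≥ 0` of unit mass with `support kₙ ⊆ B(0, δₙ)`, `δₙ → 0`: for every `η > 0`, eventually
`‖(kₙ ⋆ F)(y) - F(y)‖ ≤ η` for all `y`. [folklore] -/
theorem eventually_forall_norm_convolution_sub_le {F : UnitAddTorus d → F'} (hF : Continuous F)
    {k : ℕ → UnitAddTorus d → ℝ} {δ : ℕ → ℝ} (hk0 : ∀ n y, 0 ≤ k n y) (hk1 : ∀ n, ∫ y, k n y = 1)
    (hks : ∀ n, support (k n) ⊆ ball 0 (δ n)) (hδ : Tendsto δ atTop (𝓝 0)) {η : ℝ} (hη : 0 < η) :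
    ∀ᶠ n in atTop, ∀ y, ‖(k n ⋆[lsmul ℝ ℝ] F) y - F y‖ ≤ η := by
  obtain ⟨δ₀, hδ₀, hU⟩ := FunctionSpaces.Torus.exists_forall_dist_convolution_le hF hη
  filter_upwards [(tendsto_order.1 hδ).2 δ₀ hδ₀] with n hn y
  have h := hU ((hks n).trans (ball_subset_ball hn.le)) (hk0 n) (hk1 n) y
  rwa [dist_eq_norm] at h

/-- Scalar form with the kernels on the right: eventually `|(F ⋆ kₙ)(y) - F(y)| ≤ η` for all `y`.
[folklore] -/
theorem eventually_forall_abs_convolution_sub_le {F : UnitAddTorus d → ℝ} (hF : Continuous F)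
    {k : ℕ → UnitAddTorus d → ℝ} {δ : ℕ → ℝ} (hk0 : ∀ n y, 0 ≤ k n y) (hk1 : ∀ n, ∫ y, k n y = 1)
    (hks : ∀ n, support (k n) ⊆ ball 0 (δ n)) (hδ : Tendsto δ atTop (𝓝 0)) {η : ℝ} (hη : 0 < η) :
    ∀ᶠ n in atTop, ∀ y, |(F ⋆ k n) y - F y| ≤ η := by
  filter_upwards [eventually_forall_norm_convolution_sub_le hF hk0 hk1 hks hδ hη] with n hn y
  rw [FunctionSpaces.Torus.convolution_comm_real, ← Real.norm_eq_abs]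
  exact hn y

end Sup

end Torus

end Literature.Analysis.FluidPDE
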